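import Summits.BirchSwinnertonDyer.BirchSwinnertonDyer.Theorems.ByReductionTypeAtTwoSupersingularLineTorsion
import Literature.NumberTheory.EllipticCurves.PAdicBSDKatoFiniteProofs
import HarnessLib

/-!
# Route `ByReductionTypeAtTwo` (rung K4), crux `SupersingularRankZeroAtTwo` (item
# stmt-BirchSwinnertonDyer-19097), line `signed-halves-two`: the `a₂ = 0` algebraic inputs as ONE
# statement — B. D. Kim's signed `Γ`-EULER CHARACTERISTIC at `2` — from which Kobayashi's torsion
# (Thm. 1.2) and Kim's generator value (Cor. 3.15) BOTH follow by tree theorems (seat `bsd-2adic-ss-1`, GEN 3)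

HONEST FRAMING (cell `bsd-2adic`, run/shared/lean/pub/bsd-2adic/, HUMAN RULINGS D-0036/D-0059/D-0074):
THEOREMS ONLY; no definition, no named fact, no `sorry`; nothing about any Selmer group is asserted
beyond the displayed binders; nothing booked. PARTITION (D-0054): X5@2 good-ss (B1·O1; 757 r0 book230
classes) × p = 2 — types-the-object-of (the `a₂ = 0` sub-row, 208 classes: the signed-control stub(s)
of the line); closes none. bears_on: K4 (route-BirchSwinnertonDyer-ByReductionTypeAtTwo item 19097).

## What is proved, and why

Stub groups (2a) "`X⁺(E/ℚ_∞)` is `Λ`-torsion at `2`" and (2b) "a generator `g` of `char X⁺` has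
`g(0) = u · 2^{v₂ ∏c_ℓ} · #Sel_{2^∞}(E/ℚ)`" of `supersingularRankZeroAtTwo_of_line_torsion` (p432255)
are, in analytic rank `0`, two faces of ONE printed statement: B. D. Kim's `Γ`-Euler characteristic
formula for Kobayashi's signed Selmer group (J. Aust. Math. Soc. 95 (2013), Thm. 1.1 / Cor. 3.15, `p`
odd): `Sel^±(E/ℚ_∞)^Γ` is finite and
`#H⁰(Γ, Sel^±(E/ℚ_∞)) / #H¹(Γ, Sel^±(E/ℚ_∞)) ∼ #Sel_{p^∞}(E/ℚ) · ∏_ℓ c_ℓ / #E(ℚ)(p)²`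
(here `#E(ℚ)(2) = 1`: `E[2]` is irreducible at a good supersingular `2`, `P2.irr_two_of_goodSS_two`).
READ AT `2` on the REAL object `S = Sel⁺(E/ℚ_∞)` (`signedSelmerInfty W κ 1`, with
`H⁰ = endInvariants (conj_γ − 1)`, `H¹ = EndCoinvariants (conj_γ − 1)`), this is the hypothesis
schema `hEC` below, and the tree's Greenberg-Lemma-4.2 machinery for dual pairs
(`IwasawaDual.IsDualPair.*`, `Kobayashi2003.SignedSelmerDualData.isDualPair`,
`…isTorsion_of_finite_endInvariants`, all valid at every `p`) gives:

* `finite_selmerGroupPInfty_of_analyticRank_eq_zero` — GZK (`rank_eq_analyticRank_of_analyticRank_le_one`)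
  + `r_an = 0` ⇒ `Sel_{p^∞}(E/ℚ)` finite (`E(ℚ)` finite by rank `0`, `Ш` finite; tree theorem
  `finite_selmerGroupPInfty_iff`), so the schema's guard is met on the crux's class;
* `signedTorsion_two_of_eulerChar` — (EC@2) + GZK ⇒ stub group (2a) (torsion, via `S^Γ` finite);
* `signedKim_two_of_eulerChar` — (EC@2) ⇒ stub group (2b) VERBATIM (Lemma 4.2:
  `g(0)·#S_Γ = u·#S^Γ`, then cancel `#S_Γ ≠ 0` in `ℚ₂`);
* `supersingularRankZeroAtTwo_of_line_eulerChar` — the crux from FIVE stub groups: (1) PUB, (2) the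
  signed Euler characteristic at `2` (EC@2), (3) `KobayashiLowerDivisibility W 2 1`, (4) the Kato-side
  signed divisibility at `2`, (5) the `a₂ = ±2` Miller halves.

So the line's `a₂ = 0` algebraic input is ONE research statement in its printed (odd-`p`) currency:
Kim's signed Euler characteristic = Kobayashi's control theorem 9.3 at the bottom layer with exact
orders, read at `p = 2`. Nothing else changes.

References: B. D. Kim, J. Aust. Math. Soc. 95 (2013), Thm. 1.1 and Cor. 3.15 [BDKim2013];
S. Kobayashi, Invent. Math. 152 (2003), Thm. 1.2, Thm. 9.3 [Kobayashi2003]; R. Greenberg, LNM 1716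
(1999), §1 pp. 54–57, §4 Lemma 4.2 (p. 102) [GreenbergLNM1716]; R. L. Miller, LMS JCM 14 (2011)
Def. 1.1 [Miller2011LMS].
-/

set_option autoImplicit false
-- the Theorems namespace of this sub repeats the summit name by design (D-0017 nested layout)
set_option linter.dupNamespace false

noncomputable section

open scoped Classical MatrixGroups ModularForm

open CongruenceSubgroup WeierstrassCurve Literature.NumberTheory.EllipticCurves
  Literature.NumberTheory.EllipticCurves.ModularForms
  Literature.NumberTheory.EllipticCurves.Rank1Residual Literature.NumberTheory.EllipticCurves.Rank1Residual.Typed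
  Literature.NumberTheory.EllipticCurves.Kobayashi2003 Literature.NumberTheory.EllipticCurves.IwasawaDual
  ZpExtension Summit.BirchSwinnertonDyer.Rank1Residual.Supersingular

namespace Summit.BirchSwinnertonDyer.BirchSwinnertonDyer.Theorems

/-! ## §1 The guard: `Sel_{p^∞}(E/ℚ)` is finite in analytic rank `0` (GZK) -/

/-- **`Sel_{p^∞}(E/ℚ)` is finite when `ord_{s=1} L(E,s) = 0`**, granted Gross–Zagier–Kolyvagin
(`hGZK`: rank `= r_an` and `Ш` finite for `r_an ≤ 1`): `E(ℚ)` is finite in rank `0`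
(`finite_point_of_rank_zero`) and `Ш(E/ℚ)[p^∞] ≤ Ш(E/ℚ)` is finite, so the tree theorem
`finite_selmerGroupPInfty_iff` (Greenberg §1: `0 → E(ℚ) ⊗ ℚ_p/ℤ_p → Sel → Ш[p^∞] → 0`) applies.
[cite: GreenbergLNM1716, §1 pp. 54–57] [cite: Darmon2004, Thm. 3.22] -/
theorem finite_selmerGroupPInfty_of_analyticRank_eq_zero
    (hGZK : rank_eq_analyticRank_of_analyticRank_le_one) (W : WeierstrassCurve ℚ) [W.IsElliptic]
    (p : ℕ) [Fact p.Prime] (hr : W.analyticRank = 0) : Finite (W.selmerGroupPInfty p) := by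
  obtain ⟨hrank, hfin⟩ := hGZK W (by omega)
  have hmw0 : W.mordellWeilRank = 0 := by rw [hrank, hr]
  haveI hE : Finite W.toAffine.Point := W.finite_point_of_rank_zero hmw0
  haveI := hfin
  haveI hS : Finite (AddCommGroup.primaryComponent W.sha p) :=
    Finite.of_injective (fun x : AddCommGroup.primaryComponent W.sha p ↦ (x : W.sha))
      Subtype.val_injective
  exact (W.finite_selmerGroupPInfty_iff p).mpr ⟨hE, hS⟩

/-! ## §2 Kim's signed `Γ`-Euler characteristic at `2` ⇒ stub groups (2a) and (2b) -/

/-- **(EC@2) + GZK ⇒ (2a): `X⁺(E/ℚ_∞)` is `Λ`-torsion at `2` on the `a₂ = 0` sub-row.** In analytic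
rank `0`, `Sel_{2^∞}(E/ℚ)` is finite (§1), so the Euler-characteristic schema gives `Sel⁺(E/ℚ_∞)^Γ`
finite, and the tree theorem `SignedSelmerDualData.isTorsion_of_finite_endInvariants` (Greenberg
Thm. 1.4 / Lemma 4.2 shape, any `p`) gives torsion of every dual datum.
[cite: BDKim2013, Thm. 1.1 and Cor. 3.15] [cite: GreenbergLNM1716, §4 Lemma 4.2 (p. 102)]
[cite: Kobayashi2003, Thm. 1.2 (p. 2)] -/
theorem signedTorsion_two_of_eulerChar [Fact (Nat.Prime 2)]
    (hGZK : rank_eq_analyticRank_of_analyticRank_le_one)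
    (hEC : ∀ (W : WeierstrassCurve ℚ) [W.IsElliptic] [W.IsGloballyMinimal],
        ¬ W.HasCM → W.analyticRank = 0 → GoodSS W 2 → W.frobeniusTrace 2 = 0 →
        ∀ (κ : ZpExtension ℚ 2) (γ : Field.absoluteGaloisGroup ℚ),
          κ.IsCyclotomic → κ.IsTopGenerator γ → Finite (W.selmerGroupPInfty 2) →
          Finite (endInvariants (conjSignedSelmerInfty W κ 1 γ - 1)) ∧
            ∃ u : ℤ_[2]ˣ, (Nat.card (endInvariants (conjSignedSelmerInfty W κ 1 γ - 1)) : ℚ_[2]) =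
              ((u : ℤ_[2]) : ℚ_[2]) * ((2 : ℕ) : ℚ_[2]) ^ (padicValNat 2 W.tamagawaProduct) *
                (Nat.card (W.selmerGroupPInfty 2) : ℚ_[2]) *
                  (Nat.card (EndCoinvariants (conjSignedSelmerInfty W κ 1 γ - 1)) : ℚ_[2])) :
    ∀ (W : WeierstrassCurve ℚ) [W.IsElliptic] [W.IsGloballyMinimal],
      ¬ W.HasCM → W.analyticRank = 0 → GoodSS W 2 → W.frobeniusTrace 2 = 0 →
      ∀ (κ : ZpExtension ℚ 2) (γ : Field.absoluteGaloisGroup ℚ),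
        κ.IsCyclotomic → κ.IsTopGenerator γ →
        ∀ D : SignedSelmerDualData W κ γ 1, Module.IsTorsion (IwasawaAlgebra 2) D.X := by
  intro W _ _ hcm hr hss ha κ γ hκ hγ D
  have hSel : Finite (W.selmerGroupPInfty 2) :=
    finite_selmerGroupPInfty_of_analyticRank_eq_zero hGZK W 2 hr
  exact D.isTorsion_of_finite_endInvariants hγ (hEC W hcm hr hss ha κ γ hκ hγ hSel).1

/-- **(EC@2) ⇒ (2b): B. D. Kim's generator value at `2`, verbatim the stub group of
`supersingularRankZeroAtTwo_of_line(_torsion)`.** For a torsion dual datum `D` of `Sel⁺(E/ℚ_∞)` with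
`char X⁺ = (g)` and `Sel_{2^∞}(E/ℚ)` finite: Greenberg's Lemma 4.2 on the dual pair
(`IsDualPair.constantCoeff_charGenerator_mul_natCard_endCoinvariants`: `g(0)·#S_Γ = u′·#S^Γ`,
`S_Γ` finite) and the Euler-characteristic identity `#S^Γ = u·2^{v₂∏c}·#Sel·#S_Γ` give, cancelling
`#S_Γ ≠ 0` in `ℚ₂`, `g(0) = u′u · 2^{v₂∏c} · #Sel`. [cite: BDKim2013, Thm. 1.1 and Cor. 3.15 (p. 199)]
[cite: GreenbergLNM1716, §4 Lemma 4.2 (p. 102)] -/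
theorem signedKim_two_of_eulerChar [Fact (Nat.Prime 2)]
    (hEC : ∀ (W : WeierstrassCurve ℚ) [W.IsElliptic] [W.IsGloballyMinimal],
        ¬ W.HasCM → W.analyticRank = 0 → GoodSS W 2 → W.frobeniusTrace 2 = 0 →
        ∀ (κ : ZpExtension ℚ 2) (γ : Field.absoluteGaloisGroup ℚ),
          κ.IsCyclotomic → κ.IsTopGenerator γ → Finite (W.selmerGroupPInfty 2) →
          Finite (endInvariants (conjSignedSelmerInfty W κ 1 γ - 1)) ∧
            ∃ u : ℤ_[2]ˣ, (Nat.card (endInvariants (conjSignedSelmerInfty W κ 1 γ - 1)) : ℚ_[2]) =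
              ((u : ℤ_[2]) : ℚ_[2]) * ((2 : ℕ) : ℚ_[2]) ^ (padicValNat 2 W.tamagawaProduct) *
                (Nat.card (W.selmerGroupPInfty 2) : ℚ_[2]) *
                  (Nat.card (EndCoinvariants (conjSignedSelmerInfty W κ 1 γ - 1)) : ℚ_[2])) :
    ∀ (W : WeierstrassCurve ℚ) [W.IsElliptic] [W.IsGloballyMinimal],
      ¬ W.HasCM → W.analyticRank = 0 → GoodSS W 2 → W.frobeniusTrace 2 = 0 →
      ∀ (κ : ZpExtension ℚ 2) (γ : Field.absoluteGaloisGroup ℚ),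
        κ.IsCyclotomic → κ.IsTopGenerator γ →
        ∀ (D : SignedSelmerDualData W κ γ 1) [Module.Finite (IwasawaAlgebra 2) D.X],
          Module.IsTorsion (IwasawaAlgebra 2) D.X →
        ∀ g : IwasawaAlgebra 2, D.charIdeal = Ideal.span {g} → Finite (W.selmerGroupPInfty 2) →
          ∃ u : ℤ_[2]ˣ, ((PowerSeries.constantCoeff g : ℤ_[2]) : ℚ_[2]) =
            ((u : ℤ_[2]) : ℚ_[2]) * ((2 : ℕ) : ℚ_[2]) ^ (padicValNat 2 W.tamagawaProduct) *
              (Nat.card (W.selmerGroupPInfty 2) : ℚ_[2]) := by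
  intro W _ _ hcm hr hss ha κ γ hκ hγ D _ htor g hg hSel
  obtain ⟨hfinΓ, u, hu⟩ := hEC W hcm hr hss ha κ γ hκ hγ hSel
  have hdp := D.isDualPair hγ
  have hg' : Module.charIdeal (IwasawaAlgebra 2) D.X = Ideal.span {g} := hg
  haveI hfinC : Finite (EndCoinvariants (conjSignedSelmerInfty W κ 1 γ - 1)) :=
    hdp.finite_endCoinvariants_of_finite htor hfinΓ
  obtain ⟨u', hu'⟩ := hdp.constantCoeff_charGenerator_mul_natCard_endCoinvariants htor g hg' hfinΓ
  -- cast Lemma 4.2 to `ℚ₂` and substitute the Euler-characteristic identity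
  have hCpos : 0 < Nat.card (EndCoinvariants (conjSignedSelmerInfty W κ 1 γ - 1)) :=
    Nat.card_pos_iff.2 ⟨⟨0⟩, hfinC⟩
  have hC0 : (Nat.card (EndCoinvariants (conjSignedSelmerInfty W κ 1 γ - 1)) : ℚ_[2]) ≠ 0 := by
    exact_mod_cast hCpos.ne'
  have h1 : ((PowerSeries.constantCoeff g : ℤ_[2]) : ℚ_[2]) *
      (Nat.card (EndCoinvariants (conjSignedSelmerInfty W κ 1 γ - 1)) : ℚ_[2]) =
      ((u' : ℤ_[2]) : ℚ_[2]) *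
        (Nat.card (endInvariants (conjSignedSelmerInfty W κ 1 γ - 1)) : ℚ_[2]) := by
    have h := congrArg ((↑) : ℤ_[2] → ℚ_[2]) hu'
    simpa only [PadicInt.coe_mul, PadicInt.coe_natCast] using h
  rw [hu] at h1
  refine ⟨u' * u, ?_⟩
  have h2 : ((PowerSeries.constantCoeff g : ℤ_[2]) : ℚ_[2]) =
      ((u' : ℤ_[2]) : ℚ_[2]) * ((u : ℤ_[2]) : ℚ_[2]) *
        ((2 : ℕ) : ℚ_[2]) ^ (padicValNat 2 W.tamagawaProduct) *
          (Nat.card (W.selmerGroupPInfty 2) : ℚ_[2]) := by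
    apply mul_right_cancel₀ hC0
    rw [h1]
    ring
  rw [h2]
  push_cast
  ring

/-! ## §3 The composition: FIVE stub groups, the signed input as Kim's Euler characteristic -/

/-- **The crux from FIVE stub groups with the `a₂ = 0` algebraic input read as Kim's signed
`Γ`-Euler characteristic at `2`** — (1) PUB {modularity, GZK}; (2) (EC@2): on the `a₂ = 0` sub-row,
if `Sel_{2^∞}(E/ℚ)` is finite then `Sel⁺(E/ℚ_∞)^Γ` is finite and
`#Sel⁺(E/ℚ_∞)^Γ = u · 2^{v₂∏c_ℓ} · #Sel_{2^∞}(E/ℚ) · #Sel⁺(E/ℚ_∞)_Γ`, `u ∈ ℤ₂ˣ` (B. D. Kim Thm. 1.1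
/ Cor. 3.15 + Kobayashi Thm. 9.3 at `n = 0`, printed for odd `p`); (3) `KobayashiLowerDivisibility
W 2 1`; (4) the Kato-side signed divisibility at `2`; (5) the `a₂ = ±2` Miller halves — via
`supersingularRankZeroAtTwo_of_line_torsion` fed by `signedTorsion_two_of_eulerChar` and
`signedKim_two_of_eulerChar`. Composition certificate; nothing asserted beyond the binders.
[cite: BDKim2013, Thm. 1.1 and Cor. 3.15] [cite: Kobayashi2003, Thm. 1.2 and Thm. 9.3]
[cite: GreenbergLNM1716, §4 Lemma 4.2 (p. 102)] [cite: Miller2011LMS, Def. 1.1] -/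
theorem supersingularRankZeroAtTwo_of_line_eulerChar
    (hPub : nonempty_modularParametrizationData ∧ rank_eq_analyticRank_of_analyticRank_le_one)
    (hEC : ∀ (W : WeierstrassCurve ℚ) [W.IsElliptic] [W.IsGloballyMinimal],
        ¬ W.HasCM → W.analyticRank = 0 → GoodSS W 2 → W.frobeniusTrace 2 = 0 →
        ∀ (κ : ZpExtension ℚ 2) (γ : Field.absoluteGaloisGroup ℚ),
          κ.IsCyclotomic → κ.IsTopGenerator γ → Finite (W.selmerGroupPInfty 2) →
          Finite (endInvariants (conjSignedSelmerInfty W κ 1 γ - 1)) ∧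
            ∃ u : ℤ_[2]ˣ, (Nat.card (endInvariants (conjSignedSelmerInfty W κ 1 γ - 1)) : ℚ_[2]) =
              ((u : ℤ_[2]) : ℚ_[2]) * ((2 : ℕ) : ℚ_[2]) ^ (padicValNat 2 W.tamagawaProduct) *
                (Nat.card (W.selmerGroupPInfty 2) : ℚ_[2]) *
                  (Nat.card (EndCoinvariants (conjSignedSelmerInfty W κ 1 γ - 1)) : ℚ_[2]))
    (hlow : ∀ (W : WeierstrassCurve ℚ) [W.IsElliptic] [W.IsGloballyMinimal],
      ¬ W.HasCM → W.analyticRank = 0 → GoodSS W 2 → W.frobeniusTrace 2 = 0 →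
        KobayashiLowerDivisibility W 2 1)
    (hup : ∀ (W : WeierstrassCurve ℚ) [W.IsElliptic] [W.IsGloballyMinimal],
      ¬ W.HasCM → W.analyticRank = 0 → GoodSS W 2 → W.frobeniusTrace 2 = 0 →
      ∀ (κ : ZpExtension ℚ 2) (γ : Field.absoluteGaloisGroup ℚ),
        κ.IsCyclotomic → κ.IsTopGenerator γ → IsCyclotomicVariable 2 γ →
        ∀ [NeZero (W.conductorNorm ℤ)] (f : CuspForm (Gamma0 (W.conductorNorm ℤ)) 2),
          IsNewformOf W f → ∀ (ϖ : ℚ), (ϖ : ℝ) * W.realPeriodRat = plusPeriod f →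
        ∀ (Lplus Lminus : IwasawaAlgebra 2), IsPollackPair f 2 Lplus Lminus →
        ∀ (D : SignedSelmerDualData W κ γ 1),
          ∃ g h : IwasawaAlgebra 2, D.charIdeal = Ideal.span {g} ∧
            iwasawaToPowerSeries 2 (g * h) =
              PowerSeries.C (ϖ : ℚ_[2]) * iwasawaToPowerSeries 2 (kobayashiL 1 Lplus Lminus))
    (hTwo : (∀ (W : WeierstrassCurve ℚ) [W.IsElliptic] [W.IsGloballyMinimal],
        ¬ W.HasCM → W.analyticRank = 0 → GoodSS W 2 →
          (W.frobeniusTrace 2 = 2 ∨ W.frobeniusTrace 2 = -2) → MissingLowerBoundAt W 2) ∧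
      (∀ (W : WeierstrassCurve ℚ) [W.IsElliptic] [W.IsGloballyMinimal],
        ¬ W.HasCM → W.analyticRank = 0 → GoodSS W 2 →
          (W.frobeniusTrace 2 = 2 ∨ W.frobeniusTrace 2 = -2) → MissingUpperBoundAt W 2)) :
    Summit.BirchSwinnertonDyer.BirchSwinnertonDyer.Theses.ByReductionTypeAtTwo.SupersingularRankZeroAtTwo :=
  supersingularRankZeroAtTwo_of_line_torsion hPub (signedTorsion_two_of_eulerChar hPub.2 hEC)
    (signedKim_two_of_eulerChar hEC) hlow hup hTwo

end Summit.BirchSwinnertonDyer.BirchSwinnertonDyer.Theorems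

end
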